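/-
Copyright: b2b-lace packet (enumeration shard B, gen 12).  THE BESSEL `u`-REPRESENTATION of the SRW
Green-function integrals: `I_{n+1,0}(x;d) = (d^{n+1}/n!) ∫₀^∞ uⁿ ∏_μ q_u(x_μ) du` with
`q_u(m) = e^{-u} I_m(u)` the continuous-time kernel — Fitzner–van der Hofstad (5.4), Hara–Slade App. B.
d-generic; no numeral; no `sorry`.
-/
import Literature.Probability.FitznerVanDerHofstad2017.SrwLawBesselEGF
import Literature.Probability.FitznerVanDerHofstad2017.SrwISeedTail
import Mathlib.Analysis.SpecialFunctions.Gamma.Basic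
import Mathlib.Analysis.SpecialFunctions.Gaussian.GaussianIntegral
import HarnessLib

/-!
# The Bessel `u`-representation of the SRW integrals `I_{n,0}(x;d)`

Companion of `SrwLawBesselEGF.lean` (`hasSum_srwLaw_poisson`: the Poissonised law factorises,
`e^{-t} Σ_m p_m(x;d) tᵐ/m! = ∏_μ q_{t/d}(x_μ)`, `q_u(m) = srwHeatKernel u m = e^{-u} I_m(u)`) and of
`SrwISeedTail.lean` (`hasSum_choose_mul_srwLaw_srwI`: the series form
`I_{n+1,L}(x) = Σ_i C(i+n,n) p_{L+i}(x)` of the integrals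
`srwI d n L x = (2π)^{-d} ∫ D̂ˢʸᵐ(k)^L cos(k·x) / (1 - D̂(k))ⁿ dk` for `d ≥ 2n+1`).

Everything here is PROVED, `d`-generic and table-free; no named fact is introduced.

* `integral_pow_mul_exp_neg_mul_Ioi` — `∫₀^∞ uᵏ e^{-ru} du = k!/r^{k+1}` (`r > 0`; Mathlib's Gamma
  integral at a natural exponent) and `integrableOn_pow_mul_exp_neg_mul_Ioi`.
* `srwI_succ_zero_eq_integral_prod_srwHeatKernel` — **for `d ≥ 2n+3` and every `x ∈ ℤ^d`,
  `I_{n+1,0}(x;d) = (d^{n+1}/n!) ∫_{u>0} uⁿ ∏_μ q_u(x_μ) du`**: integrate the Poissonised law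
  against the Gamma density term by term (`Σ_m ∫ = ∫ Σ_m` by
  `hasSum_integral_of_summable_integral_norm`, the terms being nonnegative with sum of integrals the
  convergent series `Σ_m C(m+n,n) p_m(x) = I_{n+1,0}(x)`), and
  `srwI_succ_zero_eq_integral_prod_srwHeatKernel_div` — the same in the paper's normalisation,
  `I_{n+1,0}(x;d) = (1/n!) ∫_{t>0} tⁿ ∏_μ q_{t/d}(x_μ) dt` (`t = du`).

This is (5.4) of Fitzner–van der Hofstad, `I_{n,0}(x) = (1/(n-1)!) ∫₀^∞ t^{n-1} ∏_μ F(t,d,|x_μ|) dt`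
with `F(t,d,m) = e^{-t/d} I_m(t/d) = q_{t/d}(m)` ((5.2)), after the substitution `t = du`, i.e. the
representation by which Hara–Slade and Fitzner–van der Hofstad EVALUATE the SRW integrals; here it is
DERIVED from the series form, so that rigorous one-dimensional bounds on `q_u(m)`
(`SRWHeatKernel1D.lean`: Chernoff `abs_srwHeatKernel_le_exp`, `srwHeatKernel_decay`; `0 ≤ q_u ≤ 1`,
`Σ_m q_u(m) = 1`) can be turned into two-sided enclosures of `I_{n,0}(x;d)`.

## References

* R. Fitzner, R. van der Hofstad, *Generalized approach to the non-backtracking lace expansion*,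
  Probab. Theory Relat. Fields 169 (2017) 1041–1119, §5.1.1, (5.2)–(5.4).
  [cite: FitznerVanDerHofstad2016NoBLE, §5.1.1 (5.2)–(5.4)]
* T. Hara, G. Slade, *The lace expansion for self-avoiding walk in five or more dimensions*,
  Rev. Math. Phys. 4 (1992) 235–327, Appendix B. [cite: HaraSlade1992b, Appendix B]

## Mathlib

Used: `Real.integral_rpow_mul_exp_neg_mul_Ioi`, `Real.Gamma_nat_eq_factorial`,
`integrableOn_rpow_mul_exp_neg_mul_rpow`, `MeasureTheory.hasSum_integral_of_summable_integral_norm`,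
`Nat.add_choose_mul_factorial_mul_factorial`.
-/

noncomputable section

namespace Literature.Probability.FitznerVanDerHofstad2017

open Finset Real MeasureTheory Set
open scoped Nat
open Literature.Barriers.CriticalPhenomena.LongRangePhi4 (srwLaw srwLaw_nonneg)
open Literature.Probability.LatticeModels (srwHeatKernel)

variable {d : ℕ}

/-! ### The Gamma integral at a natural exponent -/

/-- `∫₀^∞ uᵏ e^{-ru} du = k!/r^{k+1}` for `r > 0`. [folklore] -/
theorem integral_pow_mul_exp_neg_mul_Ioi (k : ℕ) {r : ℝ} (hr : 0 < r) :
    ∫ u in Ioi (0 : ℝ), u ^ k * Real.exp (-(r * u)) = (k ! : ℝ) / r ^ (k + 1) := by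
  have h := Real.integral_rpow_mul_exp_neg_mul_Ioi (a := ((k + 1 : ℕ) : ℝ)) (by positivity) hr
  have e : ∀ u : ℝ, u ^ (((k + 1 : ℕ) : ℝ) - 1) = u ^ k := by
    intro u
    rw [show (((k + 1 : ℕ) : ℝ) - 1) = ((k : ℕ) : ℝ) by push_cast; ring, Real.rpow_natCast]
  simp_rw [e] at h
  rw [h, Real.rpow_natCast, show ((k + 1 : ℕ) : ℝ) = (k : ℝ) + 1 by push_cast; ring,
    Real.Gamma_nat_eq_factorial, one_div, inv_pow, inv_mul_eq_div]

/-- `u ↦ uᵏ e^{-ru}` is integrable on `(0, ∞)` for `r > 0`. [folklore] -/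
theorem integrableOn_pow_mul_exp_neg_mul_Ioi (k : ℕ) {r : ℝ} (hr : 0 < r) :
    IntegrableOn (fun u : ℝ => u ^ k * Real.exp (-(r * u))) (Ioi 0) := by
  have hk : (-1 : ℝ) < (k : ℝ) := by
    have := Nat.cast_nonneg (α := ℝ) k
    linarith
  have h := integrableOn_rpow_mul_exp_neg_mul_rpow (s := (k : ℝ)) (p := 1) hk le_rfl hr
  refine h.congr_fun (fun u _ => ?_) measurableSet_Ioi
  simp only [Real.rpow_natCast, Real.rpow_one, neg_mul]

/-! ### The `u`-representation -/

/-- **The Bessel `u`-representation of the SRW integrals** (Fitzner–van der Hofstad (5.4), after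
Hara–Slade App. B, with `t = du`): for `d ≥ 2n + 3` and every `x ∈ ℤ^d`,
`I_{n+1,0}(x;d) = (d^{n+1}/n!) ∫_{u>0} uⁿ ∏_μ q_u(x_μ) du`, `q_u(m) = e^{-u} I_m(u)` the law at time
`u` of the rate-one continuous-time simple random walk on `ℤ`.
[cite: FitznerVanDerHofstad2016NoBLE, §5.1.1 (5.2)–(5.4)] -/
theorem srwI_succ_zero_eq_integral_prod_srwHeatKernel (n : ℕ) (hd : 2 * n + 3 ≤ d)
    (x : Fin d → ℤ) :
    srwI d (n + 1) 0 x
      = (d : ℝ) ^ (n + 1) / (n ! : ℝ) * ∫ u in Ioi (0 : ℝ), u ^ n * ∏ μ : Fin d, srwHeatKernel u (x μ) := by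
  have hd1 : 1 ≤ d := by omega
  have hd0 : (0 : ℝ) < d := by exact_mod_cast (by omega : 0 < d)
  have hd' : (d : ℝ) ≠ 0 := hd0.ne'
  set c : ℝ := (d : ℝ) ^ (n + 1) / (n ! : ℝ) with hc
  have hc0 : 0 ≤ c := by positivity
  -- the terms: the Poissonised law against the Gamma density
  set F : ℕ → ℝ → ℝ := fun m u =>
    c * u ^ n * (Real.exp (-(d * u)) * (srwLaw d m x * (d * u) ^ m / (m ! : ℝ))) with hF
  -- (1) pointwise sum over `m`
  have hsumF : ∀ u : ℝ, HasSum (fun m => F m u) (c * u ^ n * ∏ μ : Fin d, srwHeatKernel u (x μ)) := by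
    intro u
    have h := (hasSum_srwLaw_poisson hd1 x (d * u)).mul_left (c * u ^ n)
    rwa [mul_div_cancel_left₀ u hd'] at h
  -- (2) each term as a multiple of `u^{m+n} e^{-du}`
  set K : ℕ → ℝ := fun m => c * srwLaw d m x * (d : ℝ) ^ m / (m ! : ℝ) with hK
  have hF_eq : ∀ m u, F m u = K m * (u ^ (m + n) * Real.exp (-(d * u))) := by
    intro m u
    simp only [hF, hK, mul_pow, pow_add]
    ring
  have hK0 : ∀ m, 0 ≤ K m := fun m => by
    simp only [hK]
    exact div_nonneg (mul_nonneg (mul_nonneg hc0 (srwLaw_nonneg m x)) (pow_nonneg hd0.le m))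
      (Nat.cast_nonneg _)
  have hF0 : ∀ m, ∀ u ∈ Ioi (0 : ℝ), 0 ≤ F m u := fun m u hu => by
    rw [hF_eq]
    exact mul_nonneg (hK0 m) (mul_nonneg (pow_nonneg (le_of_lt hu) _) (Real.exp_pos _).le)
  -- (3) integrability and the value of each term's integral
  have hFi : ∀ m, Integrable (F m) (volume.restrict (Ioi 0)) := fun m => by
    have h : IntegrableOn (fun u : ℝ => K m * (u ^ (m + n) * Real.exp (-(d * u)))) (Ioi 0) :=
      (integrableOn_pow_mul_exp_neg_mul_Ioi (m + n) hd0).const_mul (K m)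
    exact h.congr_fun (fun u _ => (hF_eq m u).symm) measurableSet_Ioi
  have key : ∀ m, (((m + n).choose n : ℕ) : ℝ) * ((m ! : ℝ) * (n ! : ℝ)) = ((m + n)! : ℝ) := fun m => by
    rw [← mul_assoc]
    exact_mod_cast Nat.add_choose_mul_factorial_mul_factorial m n
  have hFint : ∀ m, ∫ u in Ioi (0 : ℝ), F m u = (((m + n).choose n : ℕ) : ℝ) * srwLaw d m x := by
    intro m
    simp_rw [hF_eq]
    rw [integral_const_mul, integral_pow_mul_exp_neg_mul_Ioi (m + n) hd0]
    have hpow : (d : ℝ) ^ (n + 1) * (d : ℝ) ^ m / (d : ℝ) ^ (m + n + 1) = 1 := by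
      rw [← pow_add, show n + 1 + m = m + n + 1 by omega, div_self (pow_ne_zero _ hd')]
    have hC : (((m + n)! : ℝ)) / ((m ! : ℝ) * (n ! : ℝ)) = (((m + n).choose n : ℕ) : ℝ) := by
      rw [div_eq_iff (by positivity), key]
    calc K m * (((m + n)! : ℝ) / (d : ℝ) ^ (m + n + 1))
        = srwLaw d m x * ((((m + n)! : ℝ)) / ((m ! : ℝ) * (n ! : ℝ)))
            * ((d : ℝ) ^ (n + 1) * (d : ℝ) ^ m / (d : ℝ) ^ (m + n + 1)) := by
          simp only [hK, hc]
          ring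
      _ = (((m + n).choose n : ℕ) : ℝ) * srwLaw d m x := by rw [hpow, hC]; ring
  -- (4) summability of the integrals of the norms (= the integrals)
  have hnorm : ∀ m, ∫ u in Ioi (0 : ℝ), ‖F m u‖ = (((m + n).choose n : ℕ) : ℝ) * srwLaw d m x := by
    intro m
    rw [← hFint m]
    exact setIntegral_congr_fun measurableSet_Ioi fun u hu => Real.norm_of_nonneg (hF0 m u hu)
  have hser := hasSum_choose_mul_srwLaw_srwI n hd 0 x
  simp_rw [zero_add] at hser
  have hsum : Summable fun m => ∫ u in Ioi (0 : ℝ), ‖F m u‖ := by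
    simp_rw [hnorm]
    exact hser.summable
  -- (5) interchange and identify both sides
  have hswap := hasSum_integral_of_summable_integral_norm (μ := volume.restrict (Ioi 0)) hFi hsum
  simp_rw [hFint] at hswap
  have hlhs : srwI d (n + 1) 0 x = ∫ u in Ioi (0 : ℝ), ∑' m, F m u := hser.unique hswap
  rw [hlhs, ← integral_const_mul]
  refine integral_congr_ae (Filter.Eventually.of_forall fun u => ?_)
  show ∑' m, F m u = c * (u ^ n * ∏ μ : Fin d, srwHeatKernel u (x μ))
  rw [(hsumF u).tsum_eq, mul_assoc]

/-- The same in the normalisation of Fitzner–van der Hofstad (5.4) (`t = du`): for `d ≥ 2n + 3`,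
`I_{n+1,0}(x;d) = (1/n!) ∫_{t>0} tⁿ ∏_μ F(t,d,x_μ) dt` with `F(t,d,m) = e^{-t/d} I_m(t/d) = q_{t/d}(m)`
((5.2); `srwHeatKernel_eq_exp_neg_mul_besselI`). [cite: FitznerVanDerHofstad2016NoBLE, §5.1.1 (5.2)–(5.4)] -/
theorem srwI_succ_zero_eq_integral_prod_srwHeatKernel_div (n : ℕ) (hd : 2 * n + 3 ≤ d)
    (x : Fin d → ℤ) :
    srwI d (n + 1) 0 x
      = 1 / (n ! : ℝ) * ∫ t in Ioi (0 : ℝ), t ^ n * ∏ μ : Fin d, srwHeatKernel (t / d) (x μ) := by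
  rw [srwI_succ_zero_eq_integral_prod_srwHeatKernel n hd x]
  have hd0 : (0 : ℝ) < d := by exact_mod_cast (by omega : 0 < d)
  have hd' : (d : ℝ) ≠ 0 := hd0.ne'
  have h := integral_comp_mul_left_Ioi
    (fun t : ℝ => t ^ n * ∏ μ : Fin d, srwHeatKernel (t / d) (x μ)) 0 hd0
  simp only [mul_zero, smul_eq_mul] at h
  have e : ∀ u : ℝ, (d * u) ^ n * ∏ μ : Fin d, srwHeatKernel (d * u / d) (x μ)
      = (d : ℝ) ^ n * (u ^ n * ∏ μ : Fin d, srwHeatKernel u (x μ)) := by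
    intro u
    rw [mul_div_cancel_left₀ u hd', mul_pow, mul_assoc]
  simp_rw [e] at h
  rw [integral_const_mul] at h
  have hJ : ∫ u in Ioi (0 : ℝ), u ^ n * ∏ μ : Fin d, srwHeatKernel u (x μ)
      = ((d : ℝ) ^ n)⁻¹ * ((d : ℝ)⁻¹ * ∫ t in Ioi (0 : ℝ), t ^ n * ∏ μ : Fin d, srwHeatKernel (t / d) (x μ)) := by
    rw [← h, ← mul_assoc, inv_mul_cancel₀ (pow_ne_zero n hd'), one_mul]
  rw [hJ, ← mul_assoc, ← mul_assoc]
  congr 1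
  rw [pow_succ]
  field_simp

end Literature.Probability.FitznerVanDerHofstad2017
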